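import Mathlib
import Summits.KontsevichZagierPeriods.Zeta5Search.DenomLaw.ThresholdSelectionTable
import Summits.KontsevichZagierPeriods.Zeta5Search.DenomLaw.ThresholdModelDict

/-!
# ζ(5) search — DENOM-LAW D1: the BRIDGE from the ρ-model (`ThresholdModelRho`) to the selection table (`ThresholdSelectionTable`) — THEOREM S assembled

Cell `pub-zeta5`, track DENOM-LAW (D1), K1 typing order item (1), denom-prover-d1 g5.  HONEST FRAMING: systematic search; MODEL/structure
side — elementary integer bookkeeping; nothing about ζ(5); no γ; no irrationality claim; records in print UNMOVED.

Dictionary (THRESHOLD-X3 §2 (c)): theory-d1 g9's root type `(L, R, n₊, n₋)` (`RType` of `ThresholdSelectionTable`, with `a_j = p − ρ_j`,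
`A = 2p − R₀`) is engine-d2 g11's `(L, R, np, nm)` of `ThresholdModelRho` (ρ-coordinates); this file packages the latter as an `RType`
(`rtype`; it imports the last part `ThresholdModelDict`, where the ρ-model's (ii)/(iii) lemmas live) and transfers THEOREM S (ii) (`rtype_repSide`, from `Rho.R_le_L`, `Rho.nm_le_np`), (iii) (`rtype_mono`, from `Rho.L_mono`,
`Rho.R_anti`, `Rho.np_mono`, `Rho.nm_anti`) and the COROLLARY — the UNIT-PLÜCKER SELECTION LAW for two representative-side classes of one
cell with equal degree `δ ∈ {3,4}` (`selection_law_rtype`, from the kernel-decided table `selection_law`).  With `ThresholdModelDeep`'s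
`dominant_delta_le_four` (no dominant class has `δ ≥ 5`) this is the form in which the D2 seals (P-D2-SELECTION S1⁺) read the law.
-/

open Finset

namespace Summit.KontsevichZagierPeriods.Zeta5Search.DenomLaw.ThresholdModel

open Rho

/-- The ρ-model's root type of the class offset `u` as an `RType` (the four exponents are non-negative integers). -/
def rtype (p R0 : ℤ) (r : Fin 7 → ℤ) (u : ℤ) : RType :=
  ⟨(L p r u).toNat, (R p r u).toNat, (np p R0 u).toNat, (nm p R0 u).toNat⟩

/-- `toNat` is monotone on the (non-negative) counts. -/
theorem toNat_le_toNat_of_le {x y : ℤ} (h : x ≤ y) : x.toNat ≤ y.toNat := Int.toNat_le_toNat h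

/-- **THEOREM S (ii) for the ρ-model type**: on the representative side `u > 0` the type is rep-side (`R ≤ L`, `n₋ ≤ n₊`, extras simple). -/
theorem rtype_repSide (p R0 : ℤ) (r : Fin 7 → ℤ) {u : ℤ} (hu : 0 < u) : (rtype p R0 r u).repSide := by
  refine ⟨toNat_le_toNat_of_le (Rho.R_le_L p r hu), toNat_le_toNat_of_le (Rho.nm_le_np p R0 hu), ?_, ?_⟩
  · show (np p R0 u).toNat ≤ 1
    have := indic_le_one (2 * p - R0 ≤ u)
    unfold np; omega
  · show (nm p R0 u).toNat ≤ 1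
    have := indic_le_one (u ≤ R0 - 2 * p)
    unfold nm; omega

/-- **THEOREM S (iii) for the ρ-model type**: the types of `u ≤ u'` are ordered. -/
theorem rtype_mono (p R0 : ℤ) (r : Fin 7 → ℤ) {u u' : ℤ} (h : u ≤ u') : (rtype p R0 r u).le (rtype p R0 r u') :=
  ⟨toNat_le_toNat_of_le (Rho.L_mono p r h), toNat_le_toNat_of_le (Rho.R_anti p r h), toNat_le_toNat_of_le (Rho.np_mono p R0 h),
    toNat_le_toNat_of_le (Rho.nm_anti p R0 h)⟩

/-- The degree of the ρ-model type is engine-d2's defect `δ(u)` (all four counts are non-negative). -/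
theorem rtype_delta (p R0 : ℤ) (r : Fin 7 → ℤ) (u : ℤ) : ((rtype p R0 r u).delta : ℤ) = delta p R0 r u := by
  have h1 := countLt_nonneg r (u + p)
  have h2 := countLt_nonneg r (p - u)
  have h3 := indic_nonneg (2 * p - R0 ≤ u)
  have h4 := indic_nonneg (u ≤ R0 - 2 * p)
  unfold rtype RType.delta delta L R np nm at *
  push_cast
  rw [Int.toNat_of_nonneg h1, Int.toNat_of_nonneg h2, Int.toNat_of_nonneg h3, Int.toNat_of_nonneg h4]

/-- **THE UNIT-PLÜCKER SELECTION LAW for two classes of one cell (ρ-model).**  Two representative-side offsets `0 < u, u'` with equal defect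
`δ ∈ {3, 4}` have integer Plücker wedge `wedgeZ ∈ {0, ±4^{δ−2}}` (`σ ∈ {0, ±1}`). -/
theorem selection_law_rtype (p R0 : ℤ) (r : Fin 7 → ℤ) {u u' : ℤ} (hu : 0 < u) (hu' : 0 < u')
    (hδ : delta p R0 r u = delta p R0 r u') (h34 : delta p R0 r u = 3 ∨ delta p R0 r u = 4) :
    wedgeZ (rtype p R0 r u) (rtype p R0 r u') = 0 ∨
      wedgeZ (rtype p R0 r u) (rtype p R0 r u') = 4 ^ ((rtype p R0 r u).delta - 2) ∨
      wedgeZ (rtype p R0 r u) (rtype p R0 r u') = -(4 ^ ((rtype p R0 r u).delta - 2)) := by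
  have e1 := rtype_delta p R0 r u
  have e2 := rtype_delta p R0 r u'
  refine selection_law _ _ (rtype_repSide p R0 r hu) (rtype_repSide p R0 r hu') (by omega) (by omega) ?_
  rcases le_total u u' with h | h
  · exact Or.inl (rtype_mono p R0 r h)
  · exact Or.inr (rtype_mono p R0 r h)

end Summit.KontsevichZagierPeriods.Zeta5Search.DenomLaw.ThresholdModel
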